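import Summits.Ventures.QEC.Thresholds.LDPCThreshold
import Summits.Ventures.QEC.Thresholds.ToricCodePhenomenologicalThresholds
import Literature.InformationTheory.QuantumCodes.IrreducibleCountingThreshold
import Literature.InformationTheory.QuantumCodes.CSSErasureThreshold
import HarnessLib

/-!
# Certified code-capacity and erasure thresholds for every CSS LDPC family, with the
# Dumer–Kovalev–Pryadko constants: `p₀(w-1)` and `1/(w-1)` (check weight `w`)

Venture QEC, `Summits/Ventures/QEC/Thresholds/` (LADDER-QEC rung Q5; qec-lit-2 gen 3, packaging — as
`LDPCThreshold.lean` did for the animal-constant bound — the accepted Literature theorems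
`IrreducibleCountingThreshold.lean` (p477722) and `CSSErasureThreshold.lean` (p477275) into the cell's threshold
vocabulary `IsThresholdLowerBound` / `cssFailureFamily` / `thresholdValue`). HONEST FRAMING: UNCONDITIONAL,
kernel-tier, no named fact, no `native_decide`. The constants are the PRINTED ones of Dumer–Kovalev–Pryadko
2015 Thm. 2 (one error type of a CSS code whose checks detecting that error type have weight `≤ w`):

* `css_isThresholdLowerBound_of_rowWeight` — independent `X` (or `Z`) errors, ANY minimum-weight decoders,
  family subexponential in its distance: `p₀(w-1) = (1 - √(1 - (w-1)⁻²))/2` (the tree's `thresholdValue`,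
  the smaller root of `4(w-1)² p(1-p) = 1`) is a threshold lower bound for `cssFailureFamily H SX D`. This
  SUPERSEDES `ldpc_isThresholdLowerBound`'s `1/(4Δ⁴)` (`Δ = c(w-1)` the check-graph degree) for every CSS
  family: weight `4` (toric/surface class) `p₀(3) = (3-2√2)/6 ≈ .0286`; weight `6` (the bivariate-bicycle /
  gross-code class) `p₀(5) = (5-2√6)/10 ≈ .0101` (the tree's `thresholdValue_five` / `thresholdValue_five_bounds`, `ToricCodePhenomenologicalThresholds.lean`).
* `css_erasure_isThresholdLowerBound` — independent erasures, every consistent erasure decoder: `1/(w-1)`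
  (re-export of the Literature theorem `cssErasureThreshold` in this vocabulary; weight `4`: `1/3`,
  weight `6`: `1/5`).
No statement here is about a specific finite code; a family hypothesis `n_i r^{d_i} → 0 (0 < r < 1)` (distance
`→ ∞` faster than `log n`) is required and is NOT known for any explicit infinite bivariate-bicycle family —
the weight-6 numbers are thresholds for WHATEVER weight-6 CSS family satisfies it (e.g. hypergraph products
with `d ≍ √n` do).

## References

* [DumerKovalevPryadko2015] I. Dumer, A. A. Kovalev, L. P. Pryadko, PRL 115 (2015) 050502, Thm. 2,
  eq. (upper-bound-Nm-CSS), p. 5 (`y_c^* = 1/3`, `p_{Zc}^* ≈ 0.029` for the toric code).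
* [Gottesman2014] D. Gottesman, QIC 14 (2014) 1338, Thm. 3 (the animal-constant form it supersedes).
-/

noncomputable section

namespace Summit.Ventures.QEC.Thresholds

open Filter Topology Finset Matrix
open Literature.InformationTheory.QuantumCodes

variable {n m : ℕ → ℕ}

/-- **Code-capacity threshold `p₀(w-1)` for every CSS LDPC family under minimum-weight decoding**
(Dumer–Kovalev–Pryadko's constant): one error type, checks of weight `≤ w` (`w ≥ 2`), `1 ≤ d_i ≤` distance,
ANY minimum-weight decoders, `n_i r^{d_i} → 0` for all `0 < r < 1`; then every independent error rate
`0 ≤ p < p₀(w-1)` has failure probability `→ 0`. [cite: DumerKovalevPryadko2015, Thm 2 (y = 0)] -/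
theorem css_isThresholdLowerBound_of_rowWeight (H : ∀ i, Matrix (Fin (m i)) (Fin (n i)) (ZMod 2))
    (SX : ∀ i, Submodule (ZMod 2) (Fin (n i) → ZMod 2))
    (D : ∀ i, (Fin (m i) → ZMod 2) → (Fin (n i) → ZMod 2)) (hD : ∀ i, IsMinWeightDecoder (H i) (D i))
    {w : ℕ} (hw : 2 ≤ w) (hrow : ∀ i j, (rowSupp (H i) j).card ≤ w) (d : ℕ → ℕ) (hd1 : ∀ i, 1 ≤ d i)
    (hd : ∀ i (x : Fin (n i) → ZMod 2), H i *ᵥ x = 0 → x ∉ SX i → d i ≤ hammingNorm x)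
    (hgrowth : ∀ r : ℝ, 0 < r → r < 1 → Tendsto (fun i => (n i : ℝ) * r ^ d i) atTop (𝓝 0)) :
    IsThresholdLowerBound (cssFailureFamily H SX D) (thresholdValue ((w - 1 : ℕ) : ℝ)) := by
  classical
  intro p hp₀ hpp
  set K : ℝ := ((w - 1 : ℕ) : ℝ) with hK
  have hK1 : 1 ≤ K := by
    rw [hK]
    exact_mod_cast (show 1 ≤ w - 1 by omega)
  have hp : p ≤ 1 / 2 := le_trans hpp.le (thresholdValue_le_half K)
  -- `p < p₀(K)` and `p + p₀(K) < 1` give `4K² p(1-p) < 4K² p₀(1-p₀) = 1`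
  have h4 : 4 * K ^ 2 * (p * (1 - p)) < 1 := by
    have hsum : p + thresholdValue K < 1 := by
      have := thresholdValue_le_half K
      linarith
    have hlt := mul_one_sub_lt_mul_one_sub hpp hsum
    have hK2 : 0 < 4 * K ^ 2 := by positivity
    calc 4 * K ^ 2 * (p * (1 - p)) < 4 * K ^ 2 * (thresholdValue K * (1 - thresholdValue K)) :=
          mul_lt_mul_of_pos_left hlt hK2
      _ = 1 := four_mul_sq_mul_thresholdValue hK1
  have h := cssCodeCapacityThreshold_of_rowWeight H SX D hD hw hrow d hd1 hd hgrowth hp₀ hp h4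
  exact h

/-- **Weight-6 instance** (the bivariate-bicycle / gross-code check weight): for every CSS family with
checks of weight `≤ 6` detecting this error type, minimum-weight decoding, subexponential in its distance,
`p₀(5) ≈ .0101` is a certified code-capacity threshold lower bound (versus `(2·15²)⁻² ≈ 4.9·10⁻⁶` from
`ldpc_isThresholdLowerBound` with `Δ = 3·5`). [cite: DumerKovalevPryadko2015, Thm 2 (y = 0, w = 6)] -/
theorem css_isThresholdLowerBound_weightSix (H : ∀ i, Matrix (Fin (m i)) (Fin (n i)) (ZMod 2))
    (SX : ∀ i, Submodule (ZMod 2) (Fin (n i) → ZMod 2))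
    (D : ∀ i, (Fin (m i) → ZMod 2) → (Fin (n i) → ZMod 2)) (hD : ∀ i, IsMinWeightDecoder (H i) (D i))
    (hrow : ∀ i j, (rowSupp (H i) j).card ≤ 6) (d : ℕ → ℕ) (hd1 : ∀ i, 1 ≤ d i)
    (hd : ∀ i (x : Fin (n i) → ZMod 2), H i *ᵥ x = 0 → x ∉ SX i → d i ≤ hammingNorm x)
    (hgrowth : ∀ r : ℝ, 0 < r → r < 1 → Tendsto (fun i => (n i : ℝ) * r ^ d i) atTop (𝓝 0)) :
    IsThresholdLowerBound (cssFailureFamily H SX D) (thresholdValue 5) := by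
  have h := css_isThresholdLowerBound_of_rowWeight H SX D hD (w := 6) (by norm_num) hrow d hd1 hd hgrowth
  norm_num at h
  exact h

/-- **Weight-4 instance** (surface / toric class, and any CSS family with weight-4 checks): `p₀(3) =
(3 - 2√2)/6 ≈ .0286` — DKLP's elementary toric value, now for every such family.
[cite: DumerKovalevPryadko2015, p. 5 (p_Zc* ≈ 0.029 for the toric code)] -/
theorem css_isThresholdLowerBound_weightFour (H : ∀ i, Matrix (Fin (m i)) (Fin (n i)) (ZMod 2))
    (SX : ∀ i, Submodule (ZMod 2) (Fin (n i) → ZMod 2))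
    (D : ∀ i, (Fin (m i) → ZMod 2) → (Fin (n i) → ZMod 2)) (hD : ∀ i, IsMinWeightDecoder (H i) (D i))
    (hrow : ∀ i j, (rowSupp (H i) j).card ≤ 4) (d : ℕ → ℕ) (hd1 : ∀ i, 1 ≤ d i)
    (hd : ∀ i (x : Fin (n i) → ZMod 2), H i *ᵥ x = 0 → x ∉ SX i → d i ≤ hammingNorm x)
    (hgrowth : ∀ r : ℝ, 0 < r → r < 1 → Tendsto (fun i => (n i : ℝ) * r ^ d i) atTop (𝓝 0)) :
    IsThresholdLowerBound (cssFailureFamily H SX D) (thresholdValue 3) := by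
  have h := css_isThresholdLowerBound_of_rowWeight H SX D hD (w := 4) (by norm_num) hrow d hd1 hd hgrowth
  norm_num at h
  exact h

/-- **Erasure threshold `1/(w-1)` for every CSS LDPC family**, packaged (re-export of the Literature theorem
`cssErasureThreshold` with the family `cssErasureFamily`: probability that the independent erasure pattern
of rate `y` is uncorrectable for this error type — equivalently that a consistent erasure decoder can be
made to fail). [cite: DumerKovalevPryadko2015, Thm 2 (erasure part)] -/
theorem css_erasure_isThresholdLowerBound (H : ∀ i, Matrix (Fin (m i)) (Fin (n i)) (ZMod 2))
    (SX : ∀ i, Submodule (ZMod 2) (Fin (n i) → ZMod 2)) {w : ℕ} (hw : 2 ≤ w)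
    (hrow : ∀ i j, (rowSupp (H i) j).card ≤ w) (d : ℕ → ℕ) (hd1 : ∀ i, 1 ≤ d i)
    (hd : ∀ i (x : Fin (n i) → ZMod 2), H i *ᵥ x = 0 → x ∉ SX i → d i ≤ hammingNorm x)
    (hgrowth : ∀ r : ℝ, 0 < r → r < 1 → Tendsto (fun i => (n i : ℝ) * r ^ d i) atTop (𝓝 0)) :
    IsThresholdLowerBound (cssErasureFamily H SX) (1 / ((w - 1 : ℕ) : ℝ)) :=
  cssErasureThreshold H SX hw hrow d hd1 hd hgrowth

end Summit.Ventures.QEC.Thresholds
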